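import Mathlib
import HarnessLib
import Summits.ResolutionOfSingularities.ResolutionOfSingularities.Theorems.WildQuotientsWildQuotientResolutionQuotientModelProperBirational
import Summits.ResolutionOfSingularities.ResolutionOfSingularities.Theorems.WildQuotientsWildQuotientResolutionAffineQuotientData
import Summits.ResolutionOfSingularities.ResolutionOfSingularities.Theorems.WildQuotientsWildQuotientResolutionAffineQuotientEtale

/-!
# G2 — the equivariant-model transfer for the affine quotient `Spec B → Spec B^G`, ANY finite group

(crux stmt-ResolutionOfSingularities-15640 `WildQuotients.WildQuotientResolution`, line `Sketch`;
infrastructure for ALL finite groups `G` (the crux quantifies over every finite `G`): res-L1-w45c-plan-1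
RULING 2026-08-27T16:02:41Z (1) «G2 = the crux data for a GENERAL FINITE G … the general-G twin of
S1c»; design memo `L/w45c/O9-KLEINFOUR-DESIGN.md` §5 (G2). [OURS · L1 W4.5c] — NOT a statement of any
manuscript; replaces the role of no printed item. Def-free. Prover res-L1-w45c-stub-3.)

Every rung of the chain (`jordanThree/Four/Five_hasResolution`, N4a, …) repeats a ≈ 50-line
prologue discharging, for the CONCRETE quotient datum `q_A : Spec B → Spec B^G` of a cyclic `⟨σ⟩`,
the hypotheses of `QuotientModel.quotientModel_proper_birational` /
`QuotientModel.hasResolution_of_hasResolution_glued` (faithfulness, surjectivity, orbit fibres,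
dimension, and generic étaleness through a block-specific invariant `x_a`). This file does it ONCE for
an arbitrary finite group `G` acting faithfully by `k`-algebra automorphisms on a `k`-domain `B` of
finite type:

* `exists_fixed_ne_zero_mem_augIdeal` — faithful `G`, domain `B`: a NON-ZERO invariant `t` lying in
  the augmentation ideal `(g • b − b : b)` of every `g ≠ 1` (product of the norms of moved elements);
* `exists_dense_etale_specMap_fixedPoints` — hence `q_A` is étale over the dense open `D(t)`
  (`AffineQuotient.exists_dense_etale_morphismRestrict`);
* **`hasResolution_spec_fixedPoints_of_model`** — for any `G`-equivariant proper birational integral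
  model `π : V → Spec B` with action `ρB` over `Spec B^G` covered by `G`-stable affine opens:
  `HasResolution (V/G) → HasResolution (Spec B^G)`; `…_of_isRegular_glued` — the same from
  `Scheme.IsRegular (V/G)`;
* `hasResolution_mvPolynomial_fixedPoints_of_model` — the `𝔸ⁿ` instance for a finite subgroup
  `G ≤ Aut_k k[x₁,…,xₙ]` (`zpowers σ`, `closure {σ₁, σ₂}`, …), `0 < n`;
  `hasResolution_mvPolynomial_fixedPoints_zpowers_of_model` — the cyclic letters (S1c binder order).
The action convention `ρ g = Spec (g⁻¹)` (`hρ`) is the one produced by `AffineQuotient.exists_specAction`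
and consumed by every V3U/V4U/V5 frame (`liftAction ρ hJ`), so no `g`/`g⁻¹` seam arises.
-/

-- single-problem summit: the doubled namespace component `ResolutionOfSingularities` is forced
set_option linter.dupNamespace false

noncomputable section

open CategoryTheory Limits AlgebraicGeometry TopologicalSpace
open scoped Pointwise
open Literature.AlgebraicGeometry.Resolution Literature.AlgebraicGeometry.RelativeSpec

namespace Summit.ResolutionOfSingularities.ResolutionOfSingularities.Theorems.WildQuotientResolution.AffineQuotient

/-! ## A non-zero invariant in every augmentation ideal -/

/-- **Faithful finite group actions on domains have a non-zero invariant in every augmentation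
ideal**: `t := ∏_{g ≠ 1} ∏_{h} h • (g • b_g − b_g)` for elements `b_g` moved by `g`.
[OURS · L1 W4.5c] [folklore] -/
theorem exists_fixed_ne_zero_mem_augIdeal {B : Type*} [CommRing B] [IsDomain B] {G : Type*}
    [Group G] [Finite G] [MulSemiringAction G B] [FaithfulSMul G B] :
    ∃ t : B, t ≠ 0 ∧ (∀ g : G, g • t = t) ∧
      ∀ g : G, g ≠ 1 → t ∈ Ideal.span (Set.range fun b : B => g • b - b) := by
  classical
  let _ : Fintype G := Fintype.ofFinite G
  -- each `g ≠ 1` moves some element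
  have hmove : ∀ g : G, g ≠ 1 → ∃ b : B, g • b - b ≠ 0 := by
    intro g hg
    by_contra hall
    push Not at hall
    apply hg
    exact FaithfulSMul.eq_of_smul_eq_smul (M := G) (α := B) fun b => by
      rw [one_smul]; exact sub_eq_zero.mp (hall b)
  choose! bmv hbmv using hmove
  -- norms
  let N : B → B := fun y => ∏ h : G, h • y
  have hNfix : ∀ (y : B) (g : G), g • N y = N y := by
    intro y g
    simp only [N, Finset.smul_prod', smul_smul]
    exact Fintype.prod_equiv (Equiv.mulLeft g) _ _ fun h => rfl
  have hNne : ∀ y : B, y ≠ 0 → N y ≠ 0 := by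
    intro y hy
    refine Finset.prod_ne_zero_iff.mpr fun h _ hh => hy ?_
    have := congrArg (fun z => h⁻¹ • z) hh
    simpa [smul_smul] using this
  have hNmem : ∀ y : B, N y ∈ Ideal.span ({y} : Set B) := by
    intro y
    have h1 : N y = y * ∏ h ∈ (Finset.univ : Finset G).erase 1, h • y := by
      simp only [N]
      rw [← Finset.mul_prod_erase Finset.univ _ (Finset.mem_univ (1 : G)), one_smul]
    rw [h1]
    exact Ideal.mul_mem_right _ _ (Ideal.mem_span_singleton_self y)
  -- the product over `g ≠ 1`
  let t : B := ∏ g ∈ Finset.univ.erase (1 : G), N (g • bmv g - bmv g)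
  refine ⟨t, ?_, ?_, ?_⟩
  · refine Finset.prod_ne_zero_iff.mpr fun g hg => hNne _ (hbmv g (Finset.ne_of_mem_erase hg))
  · intro g
    simp only [t, Finset.smul_prod']
    exact Finset.prod_congr rfl fun g' _ => hNfix _ g
  · intro g hg
    have hgmem : g ∈ Finset.univ.erase (1 : G) := Finset.mem_erase.mpr ⟨hg, Finset.mem_univ g⟩
    rw [show t = N (g • bmv g - bmv g) * ∏ g' ∈ (Finset.univ.erase (1 : G)).erase g,
        N (g' • bmv g' - bmv g') from (Finset.mul_prod_erase _ _ hgmem).symm]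
    refine Ideal.mul_mem_right _ _ ?_
    have hle : Ideal.span ({g • bmv g - bmv g} : Set B) ≤
        Ideal.span (Set.range fun b : B => g • b - b) :=
      Ideal.span_le.mpr (Set.singleton_subset_iff.mpr (Ideal.subset_span ⟨bmv g, rfl⟩))
    exact hle (hNmem _)

/-! ## Generic étaleness of `q_A` for a faithful action -/

/-- **`q_A : Spec B → Spec B^G` is étale over a dense open** for a finite group acting faithfully
on a `k`-domain `B`. [OURS · L1 W4.5c] [folklore; `exists_dense_etale_morphismRestrict` +
`exists_fixed_ne_zero_mem_augIdeal`] -/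
theorem exists_dense_etale_specMap_fixedPoints (k : Type) [Field k] {B : Type} [CommRing B]
    [IsDomain B] [Algebra k B] {G : Type} [Group G] [Finite G] [MulSemiringAction G B]
    [SMulCommClass G k B] [FaithfulSMul G B] :
    ∃ U : (Spec (.of (FixedPoints.subalgebra k B G))).Opens,
      Dense (U : Set (Spec (.of (FixedPoints.subalgebra k B G)))) ∧
      Etale (Spec.map (CommRingCat.ofHom (algebraMap (FixedPoints.subalgebra k B G) B)) ∣_ U) := by
  obtain ⟨t, ht0, htfix, htmem⟩ := exists_fixed_ne_zero_mem_augIdeal (B := B) (G := G)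
  have ht0' : (⟨t, htfix⟩ : FixedPoints.subalgebra k B G) ≠ 0 := fun h =>
    ht0 (congrArg Subtype.val h : ((⟨t, htfix⟩ : FixedPoints.subalgebra k B G) : B) = _)
  exact exists_dense_etale_morphismRestrict k (⟨t, htfix⟩ : FixedPoints.subalgebra k B G) ht0' htmem

/-! ## The transfer -/

/-- **G2 — the equivariant-model transfer for `Spec B → Spec B^G`, ANY finite group.** Let the
finite group `G` act faithfully by `k`-algebra automorphisms on the `k`-domain `B` of finite type and
positive dimension, `ρ g = Spec (g⁻¹)` the action on `Spec B`, and let `π : V → Spec B` be a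
`G`-equivariant proper birational integral model whose action `ρB` over `Spec B^G` admits a cover by
`G`-stable affine opens. If the glued quotient `V/G` has a resolution of singularities, so does
`Spec B^G`. [OURS · L1 W4.5c] [folklore; assembly: `QuotientModel.hasResolution_of_hasResolution_glued`
with the datum hypotheses discharged by `AffineQuotientData` / `AffineQuotientEtale`] -/
theorem hasResolution_spec_fixedPoints_of_model (k : Type) [Field k] {B : Type} [CommRing B]
    [IsDomain B] [Algebra k B] [Algebra.FiniteType k B] {G : Type} [Group G] [Finite G]
    [MulSemiringAction G B] [SMulCommClass G k B] [FaithfulSMul G B]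
    (hdim : ¬ topologicalKrullDim (Spec (CommRingCat.of B)) ≤ 0)
    (ρ : G →* Aut (Spec (CommRingCat.of B)))
    (hρ : ∀ g : G, (ρ g).hom =
      Spec.map (CommRingCat.ofHom ((MulSemiringAction.toRingEquiv G B g⁻¹ : B ≃+* B) : B →+* B)))
    (V : Scheme.{0}) (π : V ⟶ Spec (CommRingCat.of B)) [IsProper π] (hbir : IsBirational π)
    [IsIntegral V]
    (ρB : ActionOver (π ≫ Spec.map (CommRingCat.ofHom
      (algebraMap (FixedPoints.subalgebra k B G) B))) G)
    (hequiv : ∀ g : G, (ρB.aut g).hom ≫ π = π ≫ (ρ g).hom)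
    (hcov : ∀ v : V, ∃ O : ρB.StableAffineOpens, v ∈ O.1)
    (hres : Scheme.HasResolution ρB.glued) :
    Scheme.HasResolution (Spec (CommRingCat.of (FixedPoints.subalgebra k B G))) := by
  haveI : LocallyOfFiniteType (Spec.map (CommRingCat.ofHom
      (algebraMap k (FixedPoints.subalgebra k B G)))) :=
    locallyOfFiniteType_specMap_fixedPoints k
  haveI : IsFinite (Spec.map (CommRingCat.ofHom (algebraMap (FixedPoints.subalgebra k B G) B))) :=
    isFinite_specMap_fixedPoints k
  have hsurj : Function.Surjective
      (Spec.map (CommRingCat.ofHom (algebraMap (FixedPoints.subalgebra k B G) B))).base :=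
    surjective_specMap_fixedPoints k
  have horb : ∀ x y : Spec (CommRingCat.of B),
      (Spec.map (CommRingCat.ofHom (algebraMap (FixedPoints.subalgebra k B G) B))).base x =
        (Spec.map (CommRingCat.ofHom (algebraMap (FixedPoints.subalgebra k B G) B))).base y →
      ∃ g : G, (ρ g).hom.base x = y :=
    fun x y hxy => exists_specAction_base_eq k ρ hρ x y hxy
  have hfaith : Function.Injective ρ := specAction_injective ρ hρ
  have hU := exists_dense_etale_specMap_fixedPoints k (B := B) (G := G)
  have hdim' : ¬ topologicalKrullDim (Spec (CommRingCat.of (FixedPoints.subalgebra k B G))) ≤ 0 := by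
    rw [topologicalKrullDim_spec_fixedPoints k]; exact hdim
  exact QuotientModel.hasResolution_of_hasResolution_glued k (Spec (CommRingCat.of B))
    (Spec (CommRingCat.of (FixedPoints.subalgebra k B G)))
    (Spec.map (CommRingCat.ofHom (algebraMap k (FixedPoints.subalgebra k B G))))
    (Spec.map (CommRingCat.ofHom (algebraMap (FixedPoints.subalgebra k B G) B)))
    G ρ hfaith hdim' hsurj hU horb V π hbir ρB hequiv hcov hres

/-- **G2, regular form**: if the glued quotient `V/G` is REGULAR, `Spec B^G` has a resolution of
singularities (the identity of `V/G`, transported). [OURS · L1 W4.5c] [folklore] -/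
theorem hasResolution_spec_fixedPoints_of_isRegular_glued (k : Type) [Field k] {B : Type}
    [CommRing B] [IsDomain B] [Algebra k B] [Algebra.FiniteType k B] {G : Type} [Group G]
    [Finite G] [MulSemiringAction G B] [SMulCommClass G k B] [FaithfulSMul G B]
    (hdim : ¬ topologicalKrullDim (Spec (CommRingCat.of B)) ≤ 0)
    (ρ : G →* Aut (Spec (CommRingCat.of B)))
    (hρ : ∀ g : G, (ρ g).hom =
      Spec.map (CommRingCat.ofHom ((MulSemiringAction.toRingEquiv G B g⁻¹ : B ≃+* B) : B →+* B)))
    (V : Scheme.{0}) (π : V ⟶ Spec (CommRingCat.of B)) [IsProper π] (hbir : IsBirational π)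
    [IsIntegral V]
    (ρB : ActionOver (π ≫ Spec.map (CommRingCat.ofHom
      (algebraMap (FixedPoints.subalgebra k B G) B))) G)
    (hequiv : ∀ g : G, (ρB.aut g).hom ≫ π = π ≫ (ρ g).hom)
    (hcov : ∀ v : V, ∃ O : ρB.StableAffineOpens, v ∈ O.1)
    (hreg : Scheme.IsRegular ρB.glued) :
    Scheme.HasResolution (Spec (CommRingCat.of (FixedPoints.subalgebra k B G))) :=
  hasResolution_spec_fixedPoints_of_model k hdim ρ hρ V π hbir ρB hequiv hcov
    ⟨ρB.glued, 𝟙 _, ⟨inferInstance, ⟨⊤, by simp, by simp, inferInstance⟩, hreg⟩⟩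

/-! ## The `𝔸ⁿ` instance for a finite subgroup of `Aut_k k[x₁,…,xₙ]` -/

/-- A subgroup of `Aut_k k[x₁,…,xₙ]` acts faithfully on `k[x₁,…,xₙ]`. [folklore] -/
theorem faithfulSMul_subgroup_algEquiv (k : Type) [Field k] (n : ℕ)
    (G : Subgroup (MvPolynomial (Fin n) k ≃ₐ[k] MvPolynomial (Fin n) k)) :
    FaithfulSMul G (MvPolynomial (Fin n) k) :=
  ⟨fun hgh => Subtype.ext (AlgEquiv.ext fun b => hgh b)⟩

/-- **G2, `𝔸ⁿ` instance** (the letters of the 15640/17941 datum): for a finite subgroup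
`G ≤ Aut_k k[x₁,…,xₙ]`, `0 < n` (`G = zpowers σ`, `closure {σ₁, σ₂}`, …), every `G`-equivariant
proper birational integral model `π : V → 𝔸ⁿ` covered by `G`-stable affine opens over
`Spec k[x]^G` whose glued quotient `V/G` has a resolution gives `HasResolution (Spec k[x]^G)`.
[OURS · L1 W4.5c] [folklore] -/
theorem hasResolution_mvPolynomial_fixedPoints_of_model (k : Type) [Field k] (n : ℕ) (hn : 0 < n)
    (G : Subgroup (MvPolynomial (Fin n) k ≃ₐ[k] MvPolynomial (Fin n) k)) [Finite G]
    (ρ : G →* Aut (Spec (CommRingCat.of (MvPolynomial (Fin n) k))))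
    (hρ : ∀ g : G, (ρ g).hom = Spec.map (CommRingCat.ofHom
      ((MulSemiringAction.toRingEquiv G (MvPolynomial (Fin n) k) g⁻¹ :
        MvPolynomial (Fin n) k ≃+* MvPolynomial (Fin n) k) :
          MvPolynomial (Fin n) k →+* MvPolynomial (Fin n) k)))
    (V : Scheme.{0}) (π : V ⟶ Spec (CommRingCat.of (MvPolynomial (Fin n) k))) [IsProper π]
    (hbir : IsBirational π) [IsIntegral V]
    (ρB : ActionOver (π ≫ Spec.map (CommRingCat.ofHom
      (algebraMap (FixedPoints.subalgebra k (MvPolynomial (Fin n) k) G) (MvPolynomial (Fin n) k)))) G)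
    (hequiv : ∀ g : G, (ρB.aut g).hom ≫ π = π ≫ (ρ g).hom)
    (hcov : ∀ v : V, ∃ O : ρB.StableAffineOpens, v ∈ O.1)
    (hres : Scheme.HasResolution ρB.glued) :
    Scheme.HasResolution
      (Spec (CommRingCat.of (FixedPoints.subalgebra k (MvPolynomial (Fin n) k) G))) := by
  haveI := faithfulSMul_subgroup_algEquiv k n G
  have hdim : ¬ topologicalKrullDim (Spec (CommRingCat.of (MvPolynomial (Fin n) k))) ≤ 0 := by
    rw [topologicalKrullDim_spec_mvPolynomial k n]
    have hn' : (0 : WithBot ℕ∞) < (n : WithBot ℕ∞) := by exact_mod_cast hn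
    exact not_le.mpr hn'
  exact hasResolution_spec_fixedPoints_of_model k hdim ρ hρ V π hbir ρB hequiv hcov hres

/-- **G2, cyclic letters** (binder order of S1c `QuotientModel.hasResolution_of_affineSpaceModel`,
p543588: `(k) (n) (σ) [Finite (zpowers σ)]` first): the `zpowers σ` instance of
`hasResolution_mvPolynomial_fixedPoints_of_model`, so that the rung finals
(`jordanThree/Four/Five_hasResolution`, N4a, …) can replace their datum prologue by one name.
[OURS · L1 W4.5c] [folklore] -/
theorem hasResolution_mvPolynomial_fixedPoints_zpowers_of_model (k : Type) [Field k] (n : ℕ)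
    (σ : MvPolynomial (Fin n) k ≃ₐ[k] MvPolynomial (Fin n) k) [Finite ↥(Subgroup.zpowers σ)]
    (hn : 0 < n)
    (ρ : ↥(Subgroup.zpowers σ) →* Aut (Spec (CommRingCat.of (MvPolynomial (Fin n) k))))
    (hρ : ∀ g : ↥(Subgroup.zpowers σ), (ρ g).hom = Spec.map (CommRingCat.ofHom
      ((MulSemiringAction.toRingEquiv (↥(Subgroup.zpowers σ)) (MvPolynomial (Fin n) k) g⁻¹ :
        MvPolynomial (Fin n) k ≃+* MvPolynomial (Fin n) k) :
          MvPolynomial (Fin n) k →+* MvPolynomial (Fin n) k)))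
    (V : Scheme.{0}) (π : V ⟶ Spec (CommRingCat.of (MvPolynomial (Fin n) k))) [IsProper π]
    (hbir : IsBirational π) [IsIntegral V]
    (ρB : ActionOver (π ≫ Spec.map (CommRingCat.ofHom
      (algebraMap (FixedPoints.subalgebra k (MvPolynomial (Fin n) k) ↥(Subgroup.zpowers σ))
        (MvPolynomial (Fin n) k)))) ↥(Subgroup.zpowers σ))
    (hequiv : ∀ g : ↥(Subgroup.zpowers σ), (ρB.aut g).hom ≫ π = π ≫ (ρ g).hom)
    (hcov : ∀ v : V, ∃ O : ρB.StableAffineOpens, v ∈ O.1)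
    (hres : Scheme.HasResolution ρB.glued) :
    Scheme.HasResolution (Spec (CommRingCat.of
      (FixedPoints.subalgebra k (MvPolynomial (Fin n) k) ↥(Subgroup.zpowers σ)))) :=
  hasResolution_mvPolynomial_fixedPoints_of_model k n hn (Subgroup.zpowers σ) ρ hρ V π hbir ρB
    hequiv hcov hres

end Summit.ResolutionOfSingularities.ResolutionOfSingularities.Theorems.WildQuotientResolution.AffineQuotient

end
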